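import Mathlib
import Summits.CriticalPhenomena.CardyFormulaZ2.Theorems.CardyMagicRigidityPositiveConeDefs
import Summits.CriticalPhenomena.CardyFormulaZ2.Theorems.CardyMagicRigidityNestingRigidityLatticeRegularityT
import Summits.CriticalPhenomena.CardyFormulaZ2.Theorems.CardyMagicRigidityLoopLimitZ2EqTSiteEndOuterBoundary
import HarnessLib

/-!
# Type alternation along the nesting tree on site-`𝕋` (line `positive-cone-weight-doubling`)

Crux `Summit.CriticalPhenomena.CardyFormulaZ2.Theses.CardyMagicRigidity.NestingRigidity`
(stmt-CriticalPhenomena-4835), line `positive-cone-weight-doubling`, step (3) of the registered stub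
`stub_treeRigidity`: the exact LATTICE statement that DKKMO types alternate from a loop to its
parent in the nesting tree of the typed honeycomb interface loops `tEns.X δ ω = siteLoopConfig δ ω`
of ONE site configuration `ω` at ONE mesh `δ > 0` (`typeAlternation_tEns`): if `u ∈ F i`, `v ∈ F j`,
the winding interior `{W(u, ·) ≠ 0}` is strictly inside `{W(v, ·) ≠ 0}` and no loop of the
configuration sits strictly between them, then `i ≠ j`.

Mechanism (purely combinatorial, on top of the tree's winding calculus of interface polygons,
`SiteInterfaceWinding*.lean`, `SiteInterfaceSeparation.lean`, and the loops ↔ clusters dictionary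
`…LoopLimitZ2EqTSiteEndOuterBoundary.lean`):

* §1 `unbasedLoop_eq_of_loopWind_ne` — two interface loops of `ω` whose site winding numbers BOTH
  jump across one edge `a ∼ b` of `𝕋` cross the same dart, hence pass through a common face, hence
  draw the same unbased loop (`exists_rebase`, `eq_of_base_eq`); so across an edge crossed by one
  loop, every OTHER loop has equal winding numbers at the two ends (`loopWind_eq_of_ne`).
* §2 `not_parent_of_shoelace_pos` — two nested type-`1` loops `u ⊊ v` always have a type-`0` loop
  strictly between them: the closed site `b` right of the first step of `u` is outside `u` but (by
  §1) inside `v`, so its closed cluster `D` is inside `v` and finite; the outer boundary `γ` of `D`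
  (`siteEnd_exists_loop_of_finite_compl`, type `0`, winding `-1` on `D`) contains `b` and (by §1)
  the open site `a` left of that step, which is inside `u`: by the interior trichotomy
  (`interior_trichotomy`) `{W(u) ≠ 0} ⊊ {W(γ) ≠ 0}`; the open site left of the first step of `γ` is
  outside `γ` but (by §1, as `γ ≠ v` by the signs at `b`) inside `v`, and `a` is inside both, so
  `{W(γ) ≠ 0} ⊊ {W(v) ≠ 0}`.  The type-`0` case is the colour flip `ω ↦ ωᶜ` of this one
  (`reverse_compl`: reversal swaps the types and keeps the interiors, `interior_reverse`).
* §3 `typeAlternation_tEns` — assembly for members of `(tEns.X δ ω).F i`.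
-/

noncomputable section

open MeasureTheory Set Filter Metric
open scoped Real Topology BigOperators

namespace Summit.CriticalPhenomena.CardyFormulaZ2.Cruxes.NestingRigidity.PositiveConeWeightDoubling

open Literature.Probability.RandomPlanarGeometry Literature.Probability.Percolation
  Literature.Probability.LatticeModels
open Summit.CriticalPhenomena.CardyFormulaZ2.Cruxes.NestingRigidity.RingCloudTomography
open Summit.CriticalPhenomena.CardyFormulaZ2.Cruxes.NestingRigidity.MarkovCascadeOneGeneration
open Summit.CriticalPhenomena.CardyFormulaZ2.Cruxes.LoopLimitZ2EqT.HexSegment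

section Walks

variable {ω : SiteConfig (Site 2)} {f₀ f₁ : HexVertex} {w : hexGraph.Walk f₀ f₀}
  {w' : hexGraph.Walk f₁ f₁} {δ : ℝ}

/-! ## §1 Sites in the winding interior; loops jumping across a common edge coincide -/

/-- **A site lies in the winding interior of the drawn loop iff the polygon winds about it**:
sites are off the trace, where `W(siteLoopCurve δ w, ·) = loopWind δ w`. -/
theorem triMeshPoint_mem_interior_iff (hw : IsSiteInterfaceLoop ω w) (hδ : 0 < δ) (x : Site 2) :
    triMeshPoint δ x ∈ {z | (siteLoopCurve δ w).wind z ≠ 0} ↔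
      loopWind δ w (triMeshPoint δ x) ≠ 0 := by
  have hlen : 0 < w.length := by have := hw.isCycle.three_le_length; omega
  rw [mem_setOf_eq, wind_siteLoopCurve_eq_loopWind hlen (hw.triMeshPoint_not_mem_polyTrace hδ x)]

/-- **Interface loops drawing the same unbased loop wind equally about every site.** -/
theorem loopWind_eq_of_unbasedLoop_eq (hw : IsSiteInterfaceLoop ω w) (hw' : IsSiteInterfaceLoop ω w')
    (hδ : 0 < δ)
    (he : UnbasedLoop.mk (BasedLoop.mk (siteLoopCurve δ w) (isLoop_siteLoopCurve δ w)) =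
      UnbasedLoop.mk (BasedLoop.mk (siteLoopCurve δ w') (isLoop_siteLoopCurve δ w')))
    (x : Site 2) : loopWind δ w (triMeshPoint δ x) = loopWind δ w' (triMeshPoint δ x) := by
  have hlen : 0 < w.length := by have := hw.isCycle.three_le_length; omega
  have hlen' : 0 < w'.length := by have := hw'.isCycle.three_le_length; omega
  have h := congrArg (fun u : UnbasedLoop ℂ ↦ u.wind (triMeshPoint δ x)) he
  simp only [wind_mk_siteLoopCurve] at h
  rwa [wind_siteLoopCurve_eq_loopWind hlen (hw.triMeshPoint_not_mem_polyTrace hδ x),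
    wind_siteLoopCurve_eq_loopWind hlen' (hw'.triMeshPoint_not_mem_polyTrace hδ x)] at h

/-- **A jump of the winding number across an edge of `𝕋` is a crossing**: if the polygon winds
unequally about two adjacent sites `a ∼ b`, the edge `{a, b}` is the crossed edge of some step. -/
theorem exists_step_of_loopWind_ne (hw : IsSiteInterfaceLoop ω w) (hδ : 0 < δ) {a b : Site 2}
    (hab : triGraph.Adj a b) (h : loopWind δ w (triMeshPoint δ a) ≠ loopWind δ w (triMeshPoint δ b)) :
    ∃ i < w.length, (hw.lv i = a ∧ hw.rv i = b) ∨ (hw.rv i = a ∧ hw.lv i = b) := by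
  by_contra hne
  push Not at hne
  refine h (hw.loopWind_triMeshPoint_eq_of_adj hδ (Or.inr hab) fun i hi ↦ ⟨fun hh ↦ ?_, fun hh ↦ ?_⟩)
  · exact (hne i hi).1 hh.1.symm hh.2.symm
  · exact (hne i hi).2 hh.1.symm hh.2.symm

/-- **Two interface loops of one configuration whose winding numbers both jump across one edge
`a ∼ b` of `𝕋` draw the same unbased loop**: both cross the dart of `𝕋` through `{a, b}` from its
open to its closed end, so they pass through its right face; rebased there they coincide
(`IsSiteInterfaceLoop.exists_rebase`, `eq_of_base_eq`). -/
theorem unbasedLoop_eq_of_loopWind_ne (hw : IsSiteInterfaceLoop ω w) (hw' : IsSiteInterfaceLoop ω w')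
    (hδ : 0 < δ) {a b : Site 2} (hab : triGraph.Adj a b)
    (h : loopWind δ w (triMeshPoint δ a) ≠ loopWind δ w (triMeshPoint δ b))
    (h' : loopWind δ w' (triMeshPoint δ a) ≠ loopWind δ w' (triMeshPoint δ b)) :
    UnbasedLoop.mk (BasedLoop.mk (siteLoopCurve δ w) (isLoop_siteLoopCurve δ w)) =
      UnbasedLoop.mk (BasedLoop.mk (siteLoopCurve δ w') (isLoop_siteLoopCurve δ w')) := by
  obtain ⟨i, hi, hiab⟩ := exists_step_of_loopWind_ne hw hδ hab h
  obtain ⟨j, hj, hjab⟩ := exists_step_of_loopWind_ne hw' hδ hab h'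
  -- the crossed darts of `𝕋` coincide (the mixed cases contradict the colours of `a`, `b`)
  have hsame : hw.lv i = hw'.lv j ∧ hw.rv i = hw'.rv j := by
    rcases hiab with ⟨h1, h2⟩ | ⟨h1, h2⟩ <;> rcases hjab with ⟨h3, h4⟩ | ⟨h3, h4⟩
    · exact ⟨h1.trans h3.symm, h2.trans h4.symm⟩
    · have ha : a ∈ ω := h1 ▸ hw.lv_mem hi
      exact absurd ha (h3 ▸ hw'.rv_not_mem hj)
    · have ha : a ∈ ω := h3 ▸ hw'.lv_mem hj
      exact absurd ha (h1 ▸ hw.rv_not_mem hi)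
    · exact ⟨h2.trans h4.symm, h1.trans h3.symm⟩
  -- hence a common face
  obtain ⟨hadj, hfaces, -⟩ := hw.dart_spec hi
  obtain ⟨hadj', hfaces', -⟩ := hw'.dart_spec hj
  have hF : w.getVert i = w'.getVert j := by
    have hd : (⟨(hw.lv i, hw.rv i), hadj⟩ : triGraph.Dart) = ⟨(hw'.lv j, hw'.rv j), hadj'⟩ :=
      SimpleGraph.Dart.ext _ _ (Prod.ext hsame.1 hsame.2)
    rw [hd, hfaces'] at hfaces
    exact ((Prod.ext_iff.1 hfaces).2).symm
  obtain ⟨w₁, hw₁, e₁⟩ := hw.exists_rebase (w.getVert_mem_support i) δ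
  obtain ⟨w₂, hw₂, e₂⟩ := hw'.exists_rebase (show w.getVert i ∈ w'.support by
    rw [hF]; exact w'.getVert_mem_support j) δ
  rw [← e₁, ← e₂, hw₁.eq_of_base_eq hw₂]

/-- **Across an edge crossed by one interface loop, every other interface loop of the configuration
winds equally about the two ends** (contrapositive of `unbasedLoop_eq_of_loopWind_ne`). -/
theorem loopWind_eq_of_ne (hw : IsSiteInterfaceLoop ω w) (hw' : IsSiteInterfaceLoop ω w') (hδ : 0 < δ)
    (hne : UnbasedLoop.mk (BasedLoop.mk (siteLoopCurve δ w) (isLoop_siteLoopCurve δ w)) ≠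
      UnbasedLoop.mk (BasedLoop.mk (siteLoopCurve δ w') (isLoop_siteLoopCurve δ w')))
    {a b : Site 2} (hab : triGraph.Adj a b)
    (h : loopWind δ w (triMeshPoint δ a) ≠ loopWind δ w (triMeshPoint δ b)) :
    loopWind δ w' (triMeshPoint δ a) = loopWind δ w' (triMeshPoint δ b) := by
  by_contra h'
  exact hne (unbasedLoop_eq_of_loopWind_ne hw hw' hδ hab h h')

/-- **Only finitely many sites are enclosed by an interface polygon** (it does not wind about sites
farther than `|w| δ` from its first left point, `siteEnd_loopWind_eq_zero_of_lt_dist`). -/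
theorem finite_loopWind_ne_zero (hw : IsSiteInterfaceLoop ω w) (hδ : 0 < δ) :
    {x : Site 2 | loopWind δ w (triMeshPoint δ x) ≠ 0}.Finite := by
  refine (triMeshVertices_finite_holds (Ω := closedBall (hw.leftPt δ 0) (w.length * δ))
    isBounded_closedBall hδ).subset fun x hx ↦ ?_
  rw [mem_triMeshVertices_iff, mem_closedBall]
  by_contra hfar
  exact hx (siteEnd_loopWind_eq_zero_of_lt_dist hw hδ.le (not_le.1 hfar))

/-- **Reversal keeps the winding interior** (it negates the winding number). -/
theorem interior_reverse (δ : ℝ) (w : hexGraph.Walk f₀ f₀) :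
    {z | (siteLoopCurve δ w.reverse).wind z ≠ 0} = {z | (siteLoopCurve δ w).wind z ≠ 0} := by
  ext z
  simp only [mem_setOf_eq]
  rw [← wind_mk_siteLoopCurve δ w.reverse, siteEnd_unbasedLoop_reverse, UnbasedLoop.wind_reverse,
    neg_ne_zero, wind_mk_siteLoopCurve]

/-! ## §2 Two nested loops of the same type have a loop of the other type strictly between them -/

/-- **Type-`1` case.**  If `u`, `v` are type-`1` (anticlockwise) interface loops of `ω` with
`{W(u) ≠ 0} ⊊ {W(v) ≠ 0}` at mesh `δ > 0`, some interface loop `γ` of `ω` has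
`{W(u) ≠ 0} ⊊ {W(γ) ≠ 0} ⊊ {W(v) ≠ 0}` — namely the outer boundary of the (finite) closed cluster
bordering `u` from outside; so `v` is not the parent of `u`. -/
theorem not_parent_of_shoelace_pos (hδ : 0 < δ) (hu : IsSiteInterfaceLoop ω w)
    (hv : IsSiteInterfaceLoop ω w') (hsu : 0 < shoelace (w.support.map hexCenter))
    (hsv : 0 < shoelace (w'.support.map hexCenter))
    (huv : {z | (siteLoopCurve δ w).wind z ≠ 0} ⊂ {z | (siteLoopCurve δ w').wind z ≠ 0})
    (hmin : ∀ {g : HexVertex} (γ : hexGraph.Walk g g), IsSiteInterfaceLoop ω γ →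
      ¬ ({z | (siteLoopCurve δ w).wind z ≠ 0} ⊂ {z | (siteLoopCurve δ γ).wind z ≠ 0} ∧
        {z | (siteLoopCurve δ γ).wind z ≠ 0} ⊂ {z | (siteLoopCurve δ w').wind z ≠ 0})) : False := by
  have hlu : 0 < w.length := by have := hu.isCycle.three_le_length; omega
  -- the two loops differ
  have hne : UnbasedLoop.mk (BasedLoop.mk (siteLoopCurve δ w) (isLoop_siteLoopCurve δ w)) ≠
      UnbasedLoop.mk (BasedLoop.mk (siteLoopCurve δ w') (isLoop_siteLoopCurve δ w')) := fun he ↦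
    huv.ne (by
      change {z | (UnbasedLoop.mk (BasedLoop.mk (siteLoopCurve δ w) (isLoop_siteLoopCurve δ w))).wind z
        ≠ 0} = {z | (UnbasedLoop.mk (BasedLoop.mk (siteLoopCurve δ w')
          (isLoop_siteLoopCurve δ w'))).wind z ≠ 0}
      rw [he])
  -- the first step of `u`: `a` open inside, `b` closed outside `u`; both inside `v`
  set a : Site 2 := hu.lv 0 with ha_def
  set b : Site 2 := hu.rv 0 with hb_def
  have hab : triGraph.Adj a b := hu.adj_lv_rv hlu
  have hb : b ∉ ω := hu.rv_not_mem hlu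
  have hua : loopWind δ w (triMeshPoint δ a) = 1 := hu.loopWind_leftPt_eq_one_of_shoelace_pos hδ hsu hlu
  have hub : loopWind δ w (triMeshPoint δ b) = 0 :=
    hu.loopWind_rightPt_eq_zero_of_shoelace_pos hδ hsu hlu
  have hujump : loopWind δ w (triMeshPoint δ a) ≠ loopWind δ w (triMeshPoint δ b) := by
    rw [hua, hub]; exact one_ne_zero
  have haU : triMeshPoint δ a ∈ {z | (siteLoopCurve δ w).wind z ≠ 0} :=
    (triMeshPoint_mem_interior_iff hu hδ a).2 (by rw [hua]; exact one_ne_zero)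
  have hbU : triMeshPoint δ b ∉ {z | (siteLoopCurve δ w).wind z ≠ 0} := fun h ↦
    (triMeshPoint_mem_interior_iff hu hδ b).1 h hub
  have haV : triMeshPoint δ a ∈ {z | (siteLoopCurve δ w').wind z ≠ 0} := huv.1 haU
  have hva : loopWind δ w' (triMeshPoint δ a) ≠ 0 := (triMeshPoint_mem_interior_iff hv hδ a).1 haV
  have hvb : loopWind δ w' (triMeshPoint δ b) ≠ 0 := by
    rw [← loopWind_eq_of_ne hu hv hδ hne hab hujump]; exact hva
  -- the closed cluster `D` of `b` is inside `v`, hence finite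
  have hDv : ∀ x, PathIn triGraph ωᶜ b x → loopWind δ w' (triMeshPoint δ x) ≠ 0 := fun x hx ↦ by
    rw [← hv.loopWind_eq_of_pathIn_of_not_mem hδ hx]; exact hvb
  have hDfin : {x : Site 2 | PathIn triGraph ωᶜ b x}.Finite :=
    (finite_loopWind_ne_zero hv hδ).subset fun x hx ↦ hDv x hx
  -- its outer boundary `γ`: a type-`0` loop winding `-1` about `D`
  obtain ⟨g, γ, hγ, hs0, hrv⟩ := siteEnd_exists_loop_of_finite_compl hb hDfin
  have hlγ : 0 < γ.length := by have := hγ.isCycle.three_le_length; omega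
  set l : Site 2 := hγ.lv 0 with hl_def
  set r : Site 2 := hγ.rv 0 with hr_def
  have hγr : loopWind δ γ (triMeshPoint δ r) = -1 :=
    hγ.loopWind_rightPt_eq_neg_one_of_shoelace_nonpos hδ hs0 hlγ
  have hγl : loopWind δ γ (triMeshPoint δ l) = 0 :=
    hγ.loopWind_leftPt_eq_zero_of_shoelace_nonpos hδ hs0 hlγ
  have hγjump : loopWind δ γ (triMeshPoint δ l) ≠ loopWind δ γ (triMeshPoint δ r) := by
    rw [hγl, hγr]; norm_num
  have hγb : loopWind δ γ (triMeshPoint δ b) = -1 := by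
    rw [hγ.loopWind_eq_of_pathIn_of_not_mem hδ (hrv 0 hlγ)]; exact hγr
  have hbΓ : triMeshPoint δ b ∈ {z | (siteLoopCurve δ γ).wind z ≠ 0} :=
    (triMeshPoint_mem_interior_iff hγ hδ b).2 (by rw [hγb]; norm_num)
  -- `γ ≠ u`, so `a` is inside `γ` too, and `{W(u) ≠ 0} ⊊ {W(γ) ≠ 0}`
  have hneγu : UnbasedLoop.mk (BasedLoop.mk (siteLoopCurve δ w) (isLoop_siteLoopCurve δ w)) ≠
      UnbasedLoop.mk (BasedLoop.mk (siteLoopCurve δ γ) (isLoop_siteLoopCurve δ γ)) := fun he ↦ by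
    have := loopWind_eq_of_unbasedLoop_eq hu hγ hδ he b
    rw [hub, hγb] at this
    norm_num at this
  have hγa : loopWind δ γ (triMeshPoint δ a) = -1 := by
    rw [loopWind_eq_of_ne hu hγ hδ hneγu hab hujump]; exact hγb
  have haΓ : triMeshPoint δ a ∈ {z | (siteLoopCurve δ γ).wind z ≠ 0} :=
    (triMeshPoint_mem_interior_iff hγ hδ a).2 (by rw [hγa]; norm_num)
  have h1 : {z | (siteLoopCurve δ w).wind z ≠ 0} ⊂ {z | (siteLoopCurve δ γ).wind z ≠ 0} := by
    rcases interior_trichotomy hu hγ hδ with h | h | h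
    · exact absurd (h hbΓ) hbU
    · exact ⟨h, fun h' ↦ hbU (h' hbΓ)⟩
    · exact absurd haΓ (h.notMem_of_mem_left haU)
  -- `γ ≠ v` (opposite signs at `b`), so `l` is inside `v`; it is outside `γ`: `{W(γ) ≠ 0} ⊊ {W(v) ≠ 0}`
  have hvb1 : loopWind δ w' (triMeshPoint δ b) = 1 :=
    (hv.loopWind_eq_zero_or_one_of_shoelace_pos hδ hsv b).resolve_left hvb
  have hneγv : UnbasedLoop.mk (BasedLoop.mk (siteLoopCurve δ γ) (isLoop_siteLoopCurve δ γ)) ≠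
      UnbasedLoop.mk (BasedLoop.mk (siteLoopCurve δ w') (isLoop_siteLoopCurve δ w')) := fun he ↦ by
    have := loopWind_eq_of_unbasedLoop_eq hγ hv hδ he b
    rw [hγb, hvb1] at this
    norm_num at this
  have hvr : loopWind δ w' (triMeshPoint δ r) ≠ 0 := hDv r (hrv 0 hlγ)
  have hvl : loopWind δ w' (triMeshPoint δ l) ≠ 0 := by
    rw [loopWind_eq_of_ne hγ hv hδ hneγv (hγ.adj_lv_rv hlγ) hγjump]; exact hvr
  have hlV : triMeshPoint δ l ∈ {z | (siteLoopCurve δ w').wind z ≠ 0} :=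
    (triMeshPoint_mem_interior_iff hv hδ l).2 hvl
  have hlΓ : triMeshPoint δ l ∉ {z | (siteLoopCurve δ γ).wind z ≠ 0} := fun h ↦
    (triMeshPoint_mem_interior_iff hγ hδ l).1 h hγl
  have h2 : {z | (siteLoopCurve δ γ).wind z ≠ 0} ⊂ {z | (siteLoopCurve δ w').wind z ≠ 0} := by
    rcases interior_trichotomy hγ hv hδ with h | h | h
    · exact absurd (h hlV) hlΓ
    · exact ⟨h, fun h' ↦ hlΓ (h' hlV)⟩
    · exact absurd haV (h.notMem_of_mem_left haΓ)
  exact hmin γ hγ ⟨h1, h2⟩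

/-- **Type-`0` case**, the colour flip of `not_parent_of_shoelace_pos`: in `ωᶜ` the reversed walks
are type-`1` interface loops (`reverse_compl`, `siteEnd_shoelace_reverse_pos`) with the same
interiors (`interior_reverse`), and the interface loops of `ωᶜ` are the reverses of those of `ω`. -/
theorem not_parent_of_shoelace_nonpos (hδ : 0 < δ) (hu : IsSiteInterfaceLoop ω w)
    (hv : IsSiteInterfaceLoop ω w') (hsu : shoelace (w.support.map hexCenter) ≤ 0)
    (hsv : shoelace (w'.support.map hexCenter) ≤ 0)
    (huv : {z | (siteLoopCurve δ w).wind z ≠ 0} ⊂ {z | (siteLoopCurve δ w').wind z ≠ 0})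
    (hmin : ∀ {g : HexVertex} (γ : hexGraph.Walk g g), IsSiteInterfaceLoop ω γ →
      ¬ ({z | (siteLoopCurve δ w).wind z ≠ 0} ⊂ {z | (siteLoopCurve δ γ).wind z ≠ 0} ∧
        {z | (siteLoopCurve δ γ).wind z ≠ 0} ⊂ {z | (siteLoopCurve δ w').wind z ≠ 0})) : False := by
  refine not_parent_of_shoelace_pos (ω := ωᶜ) hδ hu.reverse_compl hv.reverse_compl
    (siteEnd_shoelace_reverse_pos hu hsu) (siteEnd_shoelace_reverse_pos hv hsv) ?_ ?_
  · rwa [interior_reverse, interior_reverse]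
  · intro g γ hγ
    rw [interior_reverse, interior_reverse, ← interior_reverse δ γ]
    have hγ' : IsSiteInterfaceLoop ω γ.reverse := by
      simpa only [compl_compl] using hγ.reverse_compl
    exact hmin γ.reverse hγ'

end Walks

/-! ## §3 Type alternation for the typed loop configuration `tEns.X δ ω` -/

/-- **Type alternation along the nesting tree on site-`𝕋`.**  In the typed configuration
`tEns.X δ ω = siteLoopConfig δ ω` (`δ > 0`, ANY site configuration `ω`): if `u ∈ F i`, `v ∈ F j`,
the winding interior of `u` is strictly inside that of `v`, and no loop of the configuration has
its winding interior strictly between the two (i.e. `v` is the parent of `u` in the nesting tree),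
then `i ≠ j` — a loop and its parent have opposite DKKMO types (opposite orientations: between two
like-oriented nested interface loops there is always the outer boundary of the monochromatic
cluster bordering the inner one from outside, `not_parent_of_shoelace_pos` / `…_nonpos`). -/
theorem typeAlternation_tEns : ∀ {δ : ℝ}, 0 < δ → ∀ (ω : SiteConfig (Site 2)) {i j : Fin 2} {u v : UnbasedLoop ℂ}, u ∈ (tEns.X δ ω).F i → v ∈ (tEns.X δ ω).F j → {z | u.wind z ≠ 0} ⊂ {z | v.wind z ≠ 0} → (∀ w ∈ (tEns.X δ ω).loops, ¬ ({z | u.wind z ≠ 0} ⊂ {z | w.wind z ≠ 0} ∧ {z | w.wind z ≠ 0} ⊂ {z | v.wind z ≠ 0})) → i ≠ j := by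
  rintro δ hδ ω i j u v hu hv huv hmin rfl
  obtain ⟨f, γu, hγu, htu, rfl⟩ := hu
  obtain ⟨f', γv, hγv, htv, rfl⟩ := hv
  simp only [wind_mk_siteLoopCurve] at huv hmin
  have hmin' : ∀ {g : HexVertex} (γ : hexGraph.Walk g g), IsSiteInterfaceLoop ω γ →
      ¬ ({z | (siteLoopCurve δ γu).wind z ≠ 0} ⊂ {z | (siteLoopCurve δ γ).wind z ≠ 0} ∧
        {z | (siteLoopCurve δ γ).wind z ≠ 0} ⊂ {z | (siteLoopCurve δ γv).wind z ≠ 0}) := by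
    intro g γ hγ
    have h := hmin _ (mem_loops_tEns_iff.2 ⟨g, γ, hγ, rfl⟩)
    simpa only [wind_mk_siteLoopCurve] using h
  by_cases hs : 0 < shoelace (γu.support.map hexCenter)
  · exact not_parent_of_shoelace_pos hδ hγu hγv hs (htv.1 (htu.2 hs)) huv hmin'
  · have hs' : ¬ 0 < shoelace (γv.support.map hexCenter) := fun h ↦ hs (htu.1 (htv.2 h))
    exact not_parent_of_shoelace_nonpos hδ hγu hγv (not_lt.1 hs) (not_lt.1 hs') huv hmin'

end Summit.CriticalPhenomena.CardyFormulaZ2.Cruxes.NestingRigidity.PositiveConeWeightDoubling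

end
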